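import Summits.Ventures.CertifiedArithmetic.LowPrec.DoubleRoundingThresholdWitness
import Summits.Ventures.CertifiedArithmetic.LowPrec.Exact

/-!
# Double rounding of PRODUCTS through a wider format (THEOREM D-dm, record level)

HONEST FRAMING: certified error envelopes and provably optimal rounding/accumulation schemes for
low-precision formats under stated cost models; every table by two implementations; no hardware
or vendor claims.

`fl_X(fl_Y(a · b)) = fl_X(a · b)` for all finite `a, b` of `X` — the product formed in a wider
format `Y ⊇ X` and rounded once more (both roundings the saturating round-to-nearest-even of this
packet, subnormals included). Unlike sums (THEOREM D-dr, `DoubleRounding*.lean`), a product of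
two `X`-data is NOT a whole number of `X`-quanta, so the same-precision clause (S) of D-dr FAILS
for products (e3m2 → e5m2: `3/16 · 3/16 = 9/256 ↦ 1/32 ↦ 0`, direct `1/16`; kernel witness
below), and the deciding quantity is where the product falls relative to the quantum of `Y`.
This file proves, for EVERY pair of format records:

* §1 pointwise tools: double rounding is innocuous at any `x ∈ F_Y` and at any `|x| ≥ maxRat X`
  (saturation, from `DoubleRoundingDecision.lean`), and at any `|x| < quantum_X / 2` once
  `quantum_X / 2 ∈ F_Y` (`toRat_roundNE_eq_zero_of_abs_le_half`: a tie at `± quantum_X / 2`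
  resolves to `0`, the even side);
* §2 clause (E) EXACT-OR-SATURATED: `P_Y ≥ 2 P_X`, `qexp Y ≤ 2 qexp X`, `F_X ⊆ F_Y` ⇒ innocuous
  (every product below `maxRat Y` is a `Y`-value — `exists_toRat_eq_mul_of_abs_le`, the range
  hypothesis of `exists_toRat_eq_mul` (`Exact.lean`) moved to the product — and above it both
  sides saturate);
* §3 clause (U) UNDERFLOW-SPARSE: `P_Y ≥ 2 P_X`, `qexp Y + 2 P_X ≤ qexp X`, `F_X ⊆ F_Y` ⇒ innocuous
  although `Y` cannot hold every product (`E5M2_mul_E5M2_not_exact_in_Binary16`): a product that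
  is not a `Y`-value has fewer than `2 P_X` significant bits below `Y`'s quantum, hence magnitude
  `< 2^(2 P_X - 1) · quantum_Y ≤ quantum_X / 2`, where both routes deliver `0`. This is a
  finite-format phenomenon outside the sufficient condition `emin₂ ≤ 2 emin₁` of
  [Roux2014, Table II] (Coq/Flocq, multiplication, FLT): e5m2, binary8p3, binary8p3f products
  through binary16 (`-24 + 6 ≤ -16`, `-17`);
* clause (N): a failing round trip refutes it (`b = 1`, `roundTrips_of_drMul`); the named cells
  (FP8 products through binary16 / bfloat16 / binary32, e2m1 by exhaustion, the twelve failing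
  witnesses) are `DoubleRoundingProductCells.lean`.

TWO IMPLEMENTATIONS: A = `code/enum/doublemul_decision.py` (clauses (E)/(U) on parameters, brute
force over the FP4/FP6 sources, witness search); B = this file. PLACEMENT: innocuous double
rounding of products for `p₂ ≥ 2 p₁` is KNOWN — [Figueroa1995, §3] (unbounded exponents) and
[Roux2014, Table II] (gradual underflow under `emin₂ ≤ 2 emin₁`, no overflow); clause (U), the
saturation handling and the kernel-checked finite matrix are this cell's statements over its
format records. No hardware or vendor claims.
-/

namespace Summit.Ventures.CertifiedArithmetic

open Literature.ComputerArithmetic.FloatingPoint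
open Literature.ComputerArithmetic.FloatingPoint.Format
open Literature.ComputerArithmetic.FloatingPoint.MiniFloat

/-! ## §1 Pointwise tools -/

/-- Double rounding is trivially innocuous at a value of the intermediate format. -/
theorem toRat_roundNE_roundNE_of_exists {φ ψ : Format} {x : ℚ}
    (h : ∃ z : MiniFloat ψ, z.toRat = x) :
    (roundNE φ (roundNE ψ x).toRat).toRat = (roundNE φ x).toRat := by
  rw [toRat_roundNE_of_exists h]

/-- Double rounding is innocuous in the saturated range `|x| ≥ maxRat φ` once `maxRat φ ∈ F_ψ`. -/
theorem toRat_roundNE_roundNE_of_maxRat_le_abs {φ ψ : Format}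
    (htop : ∃ z : MiniFloat ψ, z.toRat = φ.maxRat) {x : ℚ} (hx : φ.maxRat ≤ |x|) :
    (roundNE φ (roundNE ψ x).toRat).toRat = (roundNE φ x).toRat := by
  rcases le_abs'.mp hx with h | h
  · exact toRat_roundNE_roundNE_of_le_neg_maxRat htop h
  · exact toRat_roundNE_roundNE_of_maxRat_le htop h

/-- SMALL INPUTS ROUND TO ZERO, TIES INCLUDED: for `m ≥ 1`, `|y| ≤ quantum / 2 ⇒ fl(y) = 0` (at the
tie `|y| = quantum / 2` the even candidate is `0`, the odd one `± quantum`).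
[cite: IEEE7542019, §4.3.1] -/
theorem toRat_roundNE_eq_zero_of_abs_le_half {φ : Format} (h1 : 1 ≤ φ.manBits) {y : ℚ}
    (hy : |y| ≤ φ.quantum / 2) : (roundNE φ y).toRat = 0 := by
  by_contra hne
  have hq := φ.quantum_pos
  have hnear := roundNE_nearest (φ := φ) y (zero φ)
  rw [toRat_zero, sub_zero] at hnear
  have hge := quantum_le_abs_toRat (roundNE φ y) hne
  have htri := abs_sub_abs_le_abs_sub (roundNE φ y).toRat y
  rw [abs_sub_comm] at htri
  -- all inequalities are equalities: a tie between `0` and `± quantum`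
  have habs : |(roundNE φ y).toRat| = φ.quantum := le_antisymm (by linarith) hge
  have htie : |y - (zero φ).toRat| = |y - (roundNE φ y).toRat| := by
    rw [toRat_zero, sub_zero]; exact le_antisymm (by linarith) hnear
  have hne0 : (zero φ).toRat ≠ (roundNE φ y).toRat := by
    rw [toRat_zero]; intro h; exact hne h.symm
  have hev := roundNE_man_even_of_tie h1 htie hne0
  rw [two_dvd_man_iff h1] at hev
  have hS : (roundNE φ y).scaledMag = 1 := by
    have h2 := abs_toRat (roundNE φ y)
    rw [habs] at h2
    have h3 : ((roundNE φ y).scaledMag : ℚ) = 1 := by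
      have h4 : ((roundNE φ y).scaledMag : ℚ) * φ.quantum = 1 * φ.quantum := by
        rw [one_mul]; exact h2.symm
      exact mul_right_cancel₀ hq.ne' h4
    exact_mod_cast h3
  rw [hS] at hev
  have h5 := Nat.le_of_dvd Nat.one_pos hev
  have h6 := Nat.one_le_two_pow (n := (roundNE φ y).expCode - 1)
  omega

/-- Double rounding is innocuous at any `|x| < quantum_φ / 2` once `quantum_φ / 2 ∈ F_ψ`: both
routes deliver `0` (the intermediate value stays in `[-quantum_φ / 2, quantum_φ / 2]`). -/
theorem toRat_roundNE_roundNE_of_abs_lt_half {φ ψ : Format} (h1 : 1 ≤ φ.manBits)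
    (hhalf : ∃ z : MiniFloat ψ, z.toRat = φ.quantum / 2) {x : ℚ} (hx : |x| < φ.quantum / 2) :
    (roundNE φ (roundNE ψ x).toRat).toRat = (roundNE φ x).toRat := by
  have hy : |(roundNE ψ x).toRat| ≤ φ.quantum / 2 := by
    rw [abs_le]
    constructor
    · have := toRat_roundNE_mono (φ := ψ) (abs_lt.mp hx).1.le
      rwa [toRat_roundNE_neg, toRat_roundNE_of_exists hhalf] at this
    · have := toRat_roundNE_mono (φ := ψ) (abs_lt.mp hx).2.le
      rwa [toRat_roundNE_of_exists hhalf] at this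
  rw [toRat_roundNE_eq_zero_of_abs_le_half h1 hx.le, toRat_roundNE_eq_zero_of_abs_le_half h1 hy]

/-- A rational whose magnitude is a representable number of quanta is a value (either sign). -/
theorem exists_toRat_eq_of_abs_eq_natMul {ψ : Format} {x : ℚ} {n : ℕ} (hrep : ψ.Representable n)
    (hx : |x| = (n : ℚ) * ψ.quantum) : ∃ z : MiniFloat ψ, z.toRat = x := by
  obtain ⟨y, hy⟩ := exists_toRat_eq_intCast_mul (φ := ψ) (if x < 0 then -(n : ℤ) else n)
    (by split <;> simpa using hrep)
  refine ⟨y, ?_⟩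
  rw [hy]
  split
  · next h => rw [abs_of_neg h] at hx; push_cast; linarith
  · next h => rw [abs_of_nonneg (not_lt.mp h)] at hx; push_cast; linarith

/-- The magnitude of a product: `|a · b| = (|a| · |b| : ℕ quanta²) · 2^(qexp + qexp)`. -/
theorem abs_toRat_mul_toRat {φ : Format} (a b : MiniFloat φ) :
    |a.toRat * b.toRat| = ((a.scaledMag * b.scaledMag : ℕ) : ℚ) * (2 : ℚ) ^ (φ.qexp + φ.qexp) := by
  rw [abs_mul, abs_toRat, abs_toRat, zpow_add₀ (by norm_num : (2 : ℚ) ≠ 0)]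
  unfold Format.quantum
  push_cast; ring

/-- `b = 1`: innocuous double rounding of products makes the round trip `φ → ψ → φ` lossless
(for a format holding `1`). -/
theorem roundTrips_of_drMul {φ ψ : Format} (hone : ∃ o : MiniFloat φ, o.toRat = 1)
    (h : ∀ a b : MiniFloat φ, (roundNE φ (roundNE ψ (a.toRat * b.toRat)).toRat).toRat
      = (roundNE φ (a.toRat * b.toRat)).toRat) : RoundTrips φ ψ := fun x => by
  obtain ⟨o, ho⟩ := hone
  have := h x o
  rwa [ho, mul_one, toRat_roundNE_toRat] at this

/-- CLAUSE (N): a failing round-trip test (`RoundTripDecision.lean`) refutes innocuous double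
rounding of products (source of precision `≥ 2` holding `1` and `2^P · quantum`). -/
theorem not_drMul_of_roundTripTest {φ ψ : Format} (hone : ∃ o : MiniFloat φ, o.toRat = 1)
    (hψ : 1 ≤ ψ.manBits) (h2 : 2 ^ (φ.manBits + 1) ≤ φ.maxScaled)
    (ht : roundTripTest φ ψ = false) :
    ¬ ∀ a b : MiniFloat φ, (roundNE φ (roundNE ψ (a.toRat * b.toRat)).toRat).toRat
      = (roundNE φ (a.toRat * b.toRat)).toRat :=
  fun h => not_roundTrips_of_test hψ h2 ht (roundTrips_of_drMul hone h)


/-! ## §2 Clause (E): every product is a `Y`-value or saturates -/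

/-- PRODUCTS BELOW THE RANGE OF `ψ` ARE `ψ`-VALUES when `p_ψ ≥ 2 p_φ` and
`quantum_ψ ∣ quantum_φ²` (`qexp ψ ≤ 2 qexp φ`) — `exists_toRat_eq_mul` with the range hypothesis on
the product instead of the formats. [cite: MullerEtAl2018, §4.4] -/
theorem exists_toRat_eq_mul_of_abs_le {φ ψ : Format} (hm : 2 * φ.manBits + 1 ≤ ψ.manBits)
    (hq : ψ.qexp ≤ 2 * φ.qexp) (a b : MiniFloat φ) (hr : |a.toRat * b.toRat| ≤ ψ.maxRat) :
    ∃ z : MiniFloat ψ, z.toRat = a.toRat * b.toRat := by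
  have hqψ := ψ.quantum_pos
  set d := (2 * φ.qexp - ψ.qexp).toNat with hd
  have hdq : (2 : ℚ) ^ (φ.qexp + φ.qexp) = (2 : ℚ) ^ d * ψ.quantum := by
    unfold Format.quantum
    rw [← zpow_natCast, ← zpow_add₀ (by norm_num : (2 : ℚ) ≠ 0)]
    congr 1; omega
  have habs : |a.toRat * b.toRat| = ((a.scaledMag * b.scaledMag * 2 ^ d : ℕ) : ℚ) * ψ.quantum := by
    rw [abs_toRat_mul_toRat, hdq]; push_cast; ring
  refine exists_toRat_eq_of_abs_eq_natMul (representable_iff.mpr ⟨?_, ?_⟩) habs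
  · have h1 : ((a.scaledMag * b.scaledMag * 2 ^ d : ℕ) : ℚ) * ψ.quantum
        ≤ (ψ.maxScaled : ℚ) * ψ.quantum := by
      rw [← habs]; exact hr
    exact_mod_cast le_of_mul_le_mul_right h1 hqψ
  · obtain ⟨-, k₁, j₁, hk₁, h₁⟩ := representable_iff.mp a.representable_scaledMag
    obtain ⟨-, k₂, j₂, hk₂, h₂⟩ := representable_iff.mp b.representable_scaledMag
    refine ⟨k₁ * k₂, j₁ + j₂ + d, ?_, ?_⟩
    · calc k₁ * k₂ < 2 ^ (φ.manBits + 1) * 2 ^ (φ.manBits + 1) :=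
            Nat.mul_lt_mul_of_lt_of_le hk₁ hk₂.le (by positivity)
        _ = 2 ^ (2 * φ.manBits + 2) := by rw [← pow_add]; congr 1; omega
        _ ≤ 2 ^ (ψ.manBits + 1) := Nat.pow_le_pow_right (by norm_num) (by omega)
    · rw [h₁, h₂, pow_add, pow_add]; ring

/-- CLAUSE (E), pointwise form over the embedding data. -/
theorem toRat_roundNE_roundNE_mul_of_exact {φ ψ : Format} (hm : 2 * φ.manBits + 1 ≤ ψ.manBits)
    (hq : ψ.qexp ≤ 2 * φ.qexp) (htop : ∃ z : MiniFloat ψ, z.toRat = φ.maxRat)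
    (hmax : φ.maxRat ≤ ψ.maxRat) (a b : MiniFloat φ) :
    (roundNE φ (roundNE ψ (a.toRat * b.toRat)).toRat).toRat
      = (roundNE φ (a.toRat * b.toRat)).toRat := by
  rcases le_or_gt |a.toRat * b.toRat| ψ.maxRat with h | h
  · exact toRat_roundNE_roundNE_of_exists (exists_toRat_eq_mul_of_abs_le hm hq a b h)
  · exact toRat_roundNE_roundNE_of_maxRat_le_abs htop (hmax.trans h.le)

/-- CLAUSE (E) — EXACT-OR-SATURATED, every pair of records: `F_φ ⊆ F_ψ` (`embedsTest`),
`2 m_φ + 1 ≤ m_ψ` (`P_ψ ≥ 2 P_φ`) and `qexp ψ ≤ 2 qexp φ` ⇒ double rounding of products through `ψ`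
is innocuous. [cite: Figueroa1995, §3; Roux2014, Table II] -/
theorem drMul_of_exact_of_embedsTest {φ ψ : Format} (hE : embedsTest φ ψ = true)
    (hm : 2 * φ.manBits + 1 ≤ ψ.manBits) (hq : ψ.qexp ≤ 2 * φ.qexp) :
    ∀ a b : MiniFloat φ, (roundNE φ (roundNE ψ (a.toRat * b.toRat)).toRat).toRat
      = (roundNE φ (a.toRat * b.toRat)).toRat := by
  have hE' := hE
  simp only [embedsTest, Bool.and_eq_true, decide_eq_true_eq] at hE'
  obtain ⟨⟨_, hq'⟩, hM⟩ := hE'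
  exact toRat_roundNE_roundNE_mul_of_exact hm hq (exists_toRat_eq_maxRat_of_test hE)
    ((maxRat_le_maxRat_iff hq').2 hM)

/-! ## §3 Clause (U): products below the quantum of `Y` are too small to matter -/

/-- `quantum_φ / 2` is a value of `ψ` when `qexp ψ < qexp φ` and the ranges embed. -/
theorem exists_toRat_eq_half_quantum {φ ψ : Format} (hq : ψ.qexp + 1 ≤ φ.qexp)
    (hM : φ.maxScaled * 2 ^ (φ.qexp - ψ.qexp).toNat ≤ ψ.maxScaled) (h0 : 1 ≤ φ.maxScaled) :
    ∃ z : MiniFloat ψ, z.toRat = φ.quantum / 2 := by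
  set D := (φ.qexp - ψ.qexp).toNat with hD
  have hD1 : 1 ≤ D := by omega
  have hquant := quantum_eq_two_pow_mul (φ := φ) (ψ := ψ) (by omega)
  have hrep : ψ.Representable (1 * 2 ^ (D - 1)) := by
    refine representable_mul_pow (by
      have := Nat.one_le_two_pow (n := ψ.manBits); omega) ?_
    calc 1 * 2 ^ (D - 1) ≤ 1 * 2 ^ D := by
          apply Nat.mul_le_mul_left; exact Nat.pow_le_pow_right (by norm_num) (by omega)
      _ ≤ φ.maxScaled * 2 ^ D := Nat.mul_le_mul_right _ h0
      _ ≤ ψ.maxScaled := hM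
  obtain ⟨z, hz⟩ := exists_toRat_eq_natMul hrep
  refine ⟨z, ?_⟩
  rw [hz, hquant, ← hD]
  have : (2 : ℚ) ^ D = 2 * 2 ^ (D - 1) := by
    rw [← pow_succ']; congr 1; omega
  rw [this]; push_cast; ring

/-- CLAUSE (U), pointwise core: `m_φ ≥ 1`, `2 m_φ + 1 ≤ m_ψ`, `qexp ψ + 2 m_φ + 2 ≤ qexp φ`
(`= emin_Y + 2 P_X ≤ emin_X`), `quantum_φ / 2 ∈ F_ψ`, `maxRat φ ∈ F_ψ`, `maxRat φ ≤ maxRat ψ` ⇒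
innocuous at every product: the product is saturated, or a `ψ`-value, or of magnitude
`< quantum_φ / 2`. -/
theorem toRat_roundNE_roundNE_mul_of_underflow {φ ψ : Format} (h1 : 1 ≤ φ.manBits)
    (hm : 2 * φ.manBits + 1 ≤ ψ.manBits) (hu : ψ.qexp + 2 * φ.manBits + 2 ≤ φ.qexp)
    (hhalf : ∃ z : MiniFloat ψ, z.toRat = φ.quantum / 2)
    (htop : ∃ z : MiniFloat ψ, z.toRat = φ.maxRat) (hmax : φ.maxRat ≤ ψ.maxRat)
    (a b : MiniFloat φ) :
    (roundNE φ (roundNE ψ (a.toRat * b.toRat)).toRat).toRat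
      = (roundNE φ (a.toRat * b.toRat)).toRat := by
  -- exact products are clause (E)
  rcases le_or_gt ψ.qexp (2 * φ.qexp) with hq2 | hq2
  · exact toRat_roundNE_roundNE_mul_of_exact hm hq2 htop hmax a b
  -- saturated products
  rcases le_or_gt φ.maxRat |a.toRat * b.toRat| with hsat | hlt
  · exact toRat_roundNE_roundNE_of_maxRat_le_abs htop hsat
  have hqψ := ψ.quantum_pos
  set u := (ψ.qexp - 2 * φ.qexp).toNat with hud
  have hu0 : 1 ≤ u := by omega
  obtain ⟨-, k₁, j₁, hk₁, h₁⟩ := representable_iff.mp a.representable_scaledMag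
  obtain ⟨-, k₂, j₂, hk₂, h₂⟩ := representable_iff.mp b.representable_scaledMag
  have hkk : k₁ * k₂ < 2 ^ (2 * φ.manBits + 2) := by
    calc k₁ * k₂ < 2 ^ (φ.manBits + 1) * 2 ^ (φ.manBits + 1) :=
          Nat.mul_lt_mul_of_lt_of_le hk₁ hk₂.le (by positivity)
      _ = 2 ^ (2 * φ.manBits + 2) := by rw [← pow_add]; congr 1; omega
  have habs : |a.toRat * b.toRat|
      = ((k₁ * k₂ : ℕ) : ℚ) * ((2 : ℚ) ^ (j₁ + j₂) * (2 : ℚ) ^ (φ.qexp + φ.qexp)) := by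
    rw [abs_toRat_mul_toRat, h₁, h₂]; push_cast; ring
  rcases le_or_gt u (j₁ + j₂) with hj | hj
  · -- a ψ-value: `k₁ k₂ · 2^(j₁ + j₂ - u)` quanta of ψ
    apply toRat_roundNE_roundNE_of_exists
    have hpow : (2 : ℚ) ^ (j₁ + j₂) * (2 : ℚ) ^ (φ.qexp + φ.qexp)
        = (2 : ℚ) ^ (j₁ + j₂ - u) * ψ.quantum := by
      unfold Format.quantum
      rw [← zpow_natCast, ← zpow_natCast, ← zpow_add₀ (by norm_num : (2 : ℚ) ≠ 0),
        ← zpow_add₀ (by norm_num : (2 : ℚ) ≠ 0)]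
      congr 1
      rw [Nat.cast_sub hj]; push_cast; omega
    have habs' : |a.toRat * b.toRat| = ((k₁ * k₂ * 2 ^ (j₁ + j₂ - u) : ℕ) : ℚ) * ψ.quantum := by
      rw [habs, hpow]; push_cast; ring
    refine exists_toRat_eq_of_abs_eq_natMul (representable_iff.mpr ⟨?_, k₁ * k₂, j₁ + j₂ - u,
      lt_of_lt_of_le hkk (Nat.pow_le_pow_right (by norm_num) (by omega)), rfl⟩) habs'
    have hr : ((k₁ * k₂ * 2 ^ (j₁ + j₂ - u) : ℕ) : ℚ) * ψ.quantum
        ≤ (ψ.maxScaled : ℚ) * ψ.quantum := by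
      rw [← habs']; exact hlt.le.trans hmax
    exact_mod_cast le_of_mul_le_mul_right hr hqψ
  · -- too small: `|a b| < 2^(2m+1+u) · quantum_φ² = 2^(qexp ψ + 2m + 1) ≤ quantum_φ / 2`
    apply toRat_roundNE_roundNE_of_abs_lt_half h1 hhalf
    have hN : k₁ * k₂ * 2 ^ (j₁ + j₂) < 2 ^ (2 * φ.manBits + 1 + u) := by
      calc k₁ * k₂ * 2 ^ (j₁ + j₂) < 2 ^ (2 * φ.manBits + 2) * 2 ^ (u - 1) :=
            Nat.mul_lt_mul_of_lt_of_le hkk (Nat.pow_le_pow_right (by norm_num) (by omega))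
              (by positivity)
        _ = 2 ^ (2 * φ.manBits + 1 + u) := by rw [← pow_add]; congr 1; omega
    have hN' : ((k₁ * k₂ : ℕ) : ℚ) * (2 : ℚ) ^ (j₁ + j₂) < (2 : ℚ) ^ (2 * φ.manBits + 1 + u) := by
      exact_mod_cast hN
    have h2pos : (0 : ℚ) < (2 : ℚ) ^ (φ.qexp + φ.qexp) := zpow_pos (by norm_num) _
    calc |a.toRat * b.toRat|
        = ((k₁ * k₂ : ℕ) : ℚ) * (2 : ℚ) ^ (j₁ + j₂) * (2 : ℚ) ^ (φ.qexp + φ.qexp) := by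
          rw [habs]; ring
      _ < (2 : ℚ) ^ (2 * φ.manBits + 1 + u) * (2 : ℚ) ^ (φ.qexp + φ.qexp) :=
          mul_lt_mul_of_pos_right hN' h2pos
      _ = (2 : ℚ) ^ (ψ.qexp + 2 * φ.manBits + 1 : ℤ) := by
          rw [← zpow_natCast, ← zpow_add₀ (by norm_num : (2 : ℚ) ≠ 0)]
          congr 1; push_cast; omega
      _ ≤ (2 : ℚ) ^ (φ.qexp - 1 : ℤ) := zpow_le_zpow_right₀ (by norm_num) (by omega)
      _ = φ.quantum / 2 := by
          unfold Format.quantum; rw [zpow_sub_one₀ (by norm_num : (2 : ℚ) ≠ 0)]; ring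

/-- CLAUSE (U) — UNDERFLOW-SPARSE, every pair of records with `P_φ ≥ 2`: `F_φ ⊆ F_ψ`
(`embedsTest`), `2 m_φ + 1 ≤ m_ψ` and `qexp ψ + 2 m_φ + 2 ≤ qexp φ` (`emin_Y + 2 P_X ≤ emin_X`) ⇒
double rounding of products through `ψ` is innocuous — although not every product is a `ψ`-value.
Outside [Roux2014, Table II]'s sufficient condition `emin₂ ≤ 2 emin₁`. -/
theorem drMul_of_underflow_of_embedsTest {φ ψ : Format} (hE : embedsTest φ ψ = true)
    (h1 : 1 ≤ φ.manBits) (hm : 2 * φ.manBits + 1 ≤ ψ.manBits)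
    (hu : ψ.qexp + 2 * φ.manBits + 2 ≤ φ.qexp) :
    ∀ a b : MiniFloat φ, (roundNE φ (roundNE ψ (a.toRat * b.toRat)).toRat).toRat
      = (roundNE φ (a.toRat * b.toRat)).toRat := by
  have hE' := hE
  simp only [embedsTest, Bool.and_eq_true, decide_eq_true_eq] at hE'
  obtain ⟨⟨_, hq'⟩, hM⟩ := hE'
  have hmax := (maxRat_le_maxRat_iff hq').2 hM
  have htop := exists_toRat_eq_maxRat_of_test hE
  intro a b
  rcases Nat.eq_zero_or_pos φ.maxScaled with h0 | h0
  · -- degenerate record: every value is 0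
    have ha : a.toRat = 0 := by
      have := a.scaledMag_le_maxScaled
      have hs : a.scaledMag = 0 := by omega
      have h := abs_toRat a
      rw [hs] at h; simpa using h
    rw [ha, zero_mul]
    exact toRat_roundNE_roundNE_of_exists ⟨zero ψ, toRat_zero⟩
  · exact toRat_roundNE_roundNE_mul_of_underflow h1 hm hu
      (exists_toRat_eq_half_quantum (by omega) hM h0) htop hmax a b

end Summit.Ventures.CertifiedArithmetic
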